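import Summits.QuantumFields.BalabanUV.Beta.EriceRemainderEnclosureHistoryAutonomyComparisonAgeCompositionDecayHorizon

/-!
# EriceRemainderEnclosureHistoryAutonomyComparisonAgeCompositionThreeAges — (E86b) route (N), first order: THE THREE-AGE SOCKET — the damped END for a
# profile with THREE loaded ages `{1, k₂, k₃}` (every horizon, every damping of the relaxed class) MODULO the five static kernel families that (E83j)'s
# induction asks of such a profile, each DISPLAYED: (S-a) row mass of the oldest age, (S-d) or (S-a) for the pair (1, k₂), (S-b) at the ages 1 and k₂, and
# (S-c♯) above the middle age

Cell `pub-balaban`, β-function sub-cell, BINDER row D4 «RemainderConst leaves for Bałaban's split» (`HOME/BINDER-OWNERS.md`; owner lineage `b2b-balaban-beta-an4`;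
this file by co-owner #2 lineage `b2b-balaban-beta-d4-p2`, generation 77), β-FLOW TEAM duty (1), FREEZE (0) honoured (def-free; imports (E86a) `…DecayHorizon`;
uses (E86a) `flow_nonneg_of_static_families_decay_horizon`, (E81d) `flow_cum_dom_of_rowmass`, (E82e) `silent_tail_sums`, (E82c) `kernel_zero`,
(E80a) `weight_nonneg` BY NAME; nothing restated).  Successor item (2) «three loaded ages via (E83j)» of README `HOME/b2b-balaban-beta-d4-p2/g74/e83/README.md`
§4, AS A SOCKET: what (E83j) asks of three ages, literally, with the silent levels and the bookkeeping discharged.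

HONEST FRAMING (page 1, verbatim and binding).  *"Discharging BetaPertH makes Bałaban's UV stability UNCONDITIONAL — a real constructive-QFT result; it is
NOT the continuum limit and NOT the Clay problem."*  THIS FILE DISCHARGES NOTHING OF THE KIND.  Elementary real analysis about ABSTRACT functionals on a box
]0,γ]^ℕ with displayed floors, profiles and signs, and the FIRST-ORDER renewal objects of route (N) built from them — hypotheses of a census, not facts; the
form, signs, ages and moments of Bałaban's (1.22) limit functional are NOT PRINTED ([I] p. 298; GAPS G-t4-U2-1∕-2) and NOT asserted.  Row D4 class
UNCHANGED (critical-path width 0; instance 0∕1; D4 DISCHARGE NO DATE).  HONEST DEPENDENCY: continuum YM on T⁴ ⇐ BetaPertH ∧ nine spine estimates (0/9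
proved); BetaPertH ⇐ (D1) ∧ (D4) ∧ CAP+tail; G-an2-4 gates asym, D1 and NE2/3/4.

THE POINT (census sense (α); route (N); README `HOME/b2b-balaban-beta-d4-p2/g77/e86/README.md` §2).  **`flow_nonneg_three_ages_horizon`**: for a profile
with loaded ages `{1, k₂, k₃}` (`2 ≤ k₂ < k₃`, `K = k₃+1`, `L_j = 0` otherwise), `h` a box solution of an isotone memory `B` with floor `b > 0` dominated by
`L ≥ 0`, ANY damping `g` with `1∕(1+F_t) ≤ g_t ≤ 1`, ANY horizon `N ≥ K`, the first-order objects of route (N) as displayed: the comparison surplus `ε` of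
every admissible excess `e` is non-negative, GIVEN the five static families that (E83j) `nonneg_of_static_families_decay` asks of this profile —
`hrow3` (S-a)_{k₃}: the damped row mass of the OLDEST age non-increasing in the pin (it serves the pairs `(1,k₃)` AND `(k₂,k₃)`: the middle age is multi-lag,
so (E83i)'s decay route does not apply to it); `hpair12`: for the pair `(1,k₂)` EITHER (S-a)_{k₂} OR the decay family (S-d) of (E83i) with the three-age
growth factors `Hg 1`; `hSb1`: (S-b) at the youngest age (ONE inequality per pin; (E82c) proved it for TWO-age profiles only — here `Hg 1`, `M 1` see both
older ages); `hSb2`, `hSb2p`: (S-b) at the middle age (tail sums over its `k₂` lags); `hScTop`, `hScpTop`: (S-c♯) for the aggregate of the ages above `k₂`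
(= the oldest kernel) with the growth factors `HgS k₂` — forced by (E83j)'s `hlev` because the middle age is neither one-lag nor silent.  Everything else
(shift domination, chain closure, silent levels and pairs, the horizon bookkeeping) is discharged.  NUMERICS OF RECORD (`g74/numerics/o11.py`, kit
j330580, k₃ ≤ 48, affine flows, classes one∕self∕lower): ratios (S-a)_{k₃} ≤ 0.993, (S-b)_{k₂} ≤ 0.994 ∕ 0.93, (S-d)(1,k₂) ≤ 0.954, (S-c♯)_top no
violation, END margin `ε∕e ≥ 0.33`; the adversarial census of generation 77 (`g77/numerics/t3job`, kit j333869 ∕ j333871: concave shapes, free relaxed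
dampings, k₃ ≤ 128) is recorded in README `g77/e86/README.md` §3 — (S-a)-type and (S-c♯)-type families are known to FAIL in the relaxed class for two
ages at `k ≥ 64` under adversarial on∕off dampings (README `g74/e83` §2 (c)), so this socket is a statement of COST, not a claim that the cost is payable in
the relaxed class.  NOT CLAIMED: any of the five families along flows; four or more loaded ages; anything nonlinear; anything printed — NOT B12 Thm 2,
NOT BetaPertH.

WHAT IS PROVED ([folklore]; 0 `def`, 0 sorry).  **`flow_nonneg_three_ages_horizon`**.
-/
noncomputable section
open Finset

namespace Summit.QuantumFields.BalabanUV.Beta.EriceRemainderEnclosureHistoryAutonomyComparisonAgeCompositionThreeAges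

open Literature.MathematicalPhysics.QuantumFieldTheory.Balaban1983to89
open Literature.MathematicalPhysics.QuantumFieldTheory.Balaban1983to89.T4BetaStationary
open Literature.MathematicalPhysics.QuantumFieldTheory.Balaban1983to89.T4BetaFlowWellPosed
open Summit.QuantumFields.BalabanUV.Beta.EriceRemainderEnclosureHistoryAutonomyOrder (strictAnti_of_memFlow)
open Summit.QuantumFields.BalabanUV.Beta.EriceRemainderEnclosureHistoryAutonomyComparisonAgeCompositionIdentification (weight_nonneg)
open Summit.QuantumFields.BalabanUV.Beta.EriceRemainderEnclosureHistoryAutonomyComparisonAgeCompositionCriteriaFlow (flow_cum_dom_of_rowmass)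
open Summit.QuantumFields.BalabanUV.Beta.EriceRemainderEnclosureHistoryAutonomyComparisonAgeCompositionStaticEndOldestFlow (silent_tail_sums)
open Summit.QuantumFields.BalabanUV.Beta.EriceRemainderEnclosureHistoryAutonomyComparisonAgeCompositionYoungestTailSumWiring (kernel_zero)
open Summit.QuantumFields.BalabanUV.Beta.EriceRemainderEnclosureHistoryAutonomyComparisonAgeCompositionDecayHorizon
  (flow_nonneg_of_static_families_decay_horizon)

variable {B : (ℕ → ℝ) → ℝ} {γ b gIR : ℝ} {L : ℕ → ℝ} {K : ℕ} {h g : ℕ → ℝ} {KL : ℕ → ℕ → ℕ → ℝ}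

/-- **ROUTE (N), FIRST ORDER — THE THREE-AGE SOCKET: THE DAMPED END FOR `{1, k₂, k₃}`, EVERY HORIZON, EVERY DAMPING OF THE RELAXED CLASS, MODULO THE
FIVE STATIC FAMILIES (E83j) ASKS OF THREE AGES.**  `2 ≤ k₂ < k₃`, `K = k₃ + 1`, `L_j = 0` for `j ∉ {1, k₂, k₃}`; `h` a box solution of an isotone memory `B`
with floor `b > 0` dominated by `L ≥ 0`; `g` any damping with `1∕(1+F_t) ≤ g_t ≤ 1`; horizon `N ≥ K`; the first-order objects of route (N) as displayed.
DISPLAYED HYPOTHESES: `hrow3` ((S-a) for `k₃`), `hpair12` ((S-a) for `k₂` ∨ (S-d) for `(1,k₂)`), `hSb1` ((S-b) at the age 1, three-age growth), `hSb2`∕`hSb2p`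
((S-b) at the age `k₂`), `hScTop`∕`hScpTop` ((S-c♯) above `k₂`).  CONCLUSION: `ε ≥ 0` at every pin for every admissible excess `e`. [folklore] -/
theorem flow_nonneg_three_ages_horizon (hmono : ∀ u v : ℕ → ℝ, SeqBox γ u → SeqBox γ v → (∀ j, u j ≤ v j) → B u ≤ B v)
    (hL : ∀ k, 0 ≤ L k) (hb : 0 < b) (hlo : ∀ u, SeqBox γ u → b ≤ B u) (hdom : ∀ u, SeqBox γ u → ∑ k ∈ range K, L k * u k ≤ B u)
    (hh : SeqBox γ h) (hf : MemFlow B gIR h)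
    (hg : ∀ t, 0 < g t ∧ g t ≤ 1) (hgF : ∀ t, 1 / (1 + ∑ k ∈ range K, L k * h (t + k) ^ 3 / 2) ≤ g t)
    {k₂ k₃ : ℕ} (hk2 : 2 ≤ k₂) (hk23 : k₂ < k₃) (hKk : K = k₃ + 1) (hL3 : ∀ j, j < K → j ≠ 1 → j ≠ k₂ → j ≠ k₃ → L j = 0) {N : ℕ} (hKN : K ≤ N)
    (hKL : ∀ k n l, KL k n l = if 0 < k ∧ k < K ∧ l < k then L k * h (n + k) ^ 3 / 2 * ∏ t ∈ Ico (n + 1 + l) (n + k + 1), g t else 0)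
    {θ : ℕ → ℕ → ℕ → ℝ} (hθ : ∀ k n l, θ k n l = 1 - (h (n + k + l) / h (n + k)) ^ 3 * ∏ t ∈ Ico (n + k + 1) (n + k + l + 1), g t)
    {KA : ℕ → ℕ → ℕ → ℝ} {RL RA SL SA : ℕ → (ℕ → ℝ) → ℕ → ℝ}
    (hRL : ∀ i v m, RL i v m = ∑ l ∈ range K, KL i m l * v (m + 1 + l))
    (hRA : ∀ i v m, RA i v m = ∑ l ∈ range K, KA i m l * v (m + 1 + l))
    (hKA : ∀ i m l, KA i m l = KL i m l + KA (i + 1) m l) (hKAtop : ∀ m l, KA K m l = 0)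
    (hSL : ∀ i (w : ℕ → ℝ), (∀ m, N < m → w m = 0) → (∀ m, N < m → SL i w m = 0) ∧ ∀ m, SL i w m = w m - RL i (SL i w) m)
    (hSA : ∀ i (w : ℕ → ℝ), (∀ m, N < m → w m = 0) → (∀ m, N < m → SA i w m = 0) ∧ ∀ m, SA i w m = w m - RA i (SA i w) m)
    {ρ : ℕ → ℕ → ℝ} {β : ℕ → ℕ → ℕ → ℝ}
    (hρ : ∀ i n, 1 ≤ i → i ≤ K - 1 → ρ i n = (∑ l ∈ range K, KL i n l) * (1 + ∑ k ∈ Ioc i (K - 1), θ k n i * β (i + 1) n k) /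
      (1 - ∑ k ∈ Ioc i (K - 1), ∑ l ∈ range i, KL k n l))
    (hβnew : ∀ i n, 1 ≤ i → i ≤ K - 1 → β i n i = ρ i n / (1 - ρ i n))
    (hβold : ∀ i n k, 1 ≤ i → i < k → k ≤ K - 1 → β i n k = β (i + 1) n k / (1 - ρ i n))
    {Hg : ℕ → ℕ → ℝ} (hH : ∀ i m, Hg i m = (1 + ∑ k ∈ Ioc i (K - 1), θ k m 1 * β (i + 1) m k) / (1 - ∑ k ∈ Ioc i (K - 1), KL k m 0))
    {M : ℕ → ℕ → ℝ} (hM : ∀ i m, M i m = KL i m 0 + ∑ l ∈ range (K - 1), max (KL i m (l + 1) - KL i (m + 1) l) 0)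
    {HgS : ℕ → ℕ → ℕ → ℝ} (hHS : ∀ i j m, HgS i j m = (1 + ∑ k ∈ Ioc i (K - 1), θ k m 1 * β (i + 1) m k) /
      (1 - ∑ k ∈ Ioc i (K - 1), (KL k m 0 - if m + 1 + k ≤ j then KL k (m + 1) (k - 1) else 0)))
    -- THE FIVE DISPLAYED STATIC FAMILIES
    (hrow3 : ∀ n, ∑ l ∈ range k₃, KL k₃ (n + 1) l ≤ ∑ l ∈ range k₃, KL k₃ n l)
    (hpair12 : (∀ n, ∑ l ∈ range k₂, KL k₂ (n + 1) l ≤ ∑ l ∈ range k₂, KL k₂ n l) ∨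
      (∀ m, KL k₂ (m + 1) (k₂ - 1) * KL 1 (m + 1 + k₂) 0 * ∏ p ∈ Ico (m + 2) (m + 2 + k₂), Hg 1 p ≤
        KL k₂ m 0 * KL 1 (m + 1) 0 * (1 - KL 1 (m + 2) 0 * Hg 1 (m + 2))))
    (hSb1 : ∀ m, (1 + M 1 m) * (Hg 1 (m + 1) * KL 1 (m + 1) 0) ≤ KL 1 m 0)
    (hSb2 : ∀ m L', L' < k₂ → (1 + M k₂ m) * ∑ l ∈ Ico L' k₂, Hg k₂ (m + 1 + l) * KL k₂ (m + 1) l ≤ ∑ l ∈ Ico L' k₂, KL k₂ m l)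
    (hSb2p : ∀ m L₀, L₀ < k₂ → ∀ L', L' ≤ L₀ →
      (1 + M k₂ m) * ∑ l ∈ Ico L' L₀, Hg k₂ (m + 1 + l) * KL k₂ (m + 1) l ≤ ∑ l ∈ Ico L' (L₀ + 1), KL k₂ m l)
    (hScTop : ∀ m j, m + 1 + N ≤ j → ∀ L', L' < N →
      ∑ l ∈ Ico L' N, HgS k₂ j (m + 1 + l) * KA (k₂ + 1) (m + 1) l ≤ ∑ l ∈ Ico L' N, KA (k₂ + 1) m l)
    (hScpTop : ∀ m L₀, L₀ < N → ∀ L', L' ≤ L₀ →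
      ∑ l ∈ Ico L' L₀, HgS k₂ (m + 1 + L₀) (m + 1 + l) * KA (k₂ + 1) (m + 1) l ≤ ∑ l ∈ Ico L' (L₀ + 1), KA (k₂ + 1) m l)
    {e ε : ℕ → ℝ} (he0 : ∀ m, 0 ≤ e m) (hea : ∀ m, e (m + 1) ≤ e m) (het : ∀ m, N < m → e m = 0)
    (hεt : ∀ m, N < m → ε m = 0) (hεrec : ∀ m, ε m = e m - RA 1 ε m) : ∀ m, 0 ≤ ε m := by
  have hh0 : ∀ n, 0 < h n := fun n => (hh n).1
  have hanti := (strictAnti_of_memFlow hb hlo hh hf).antitone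
  have hKL0 := weight_nonneg hL hh0 hg hKL
  -- silent ages: every `j < K` other than `1, k₂, k₃`
  have hsil : ∀ j, j < K → j ≠ 1 → j ≠ k₂ → j ≠ k₃ → ∀ n l, KL j n l = 0 := fun j hj h1 h2 h3 n l => kernel_zero hKL (hL3 j hj h1 h2 h3) n l
  refine flow_nonneg_of_static_families_decay_horizon hmono hL hb hlo hdom hh hf hg hgF (by omega) hKN hKL hθ hRL hRA hKA hKAtop hSL hSA hρ hβnew
    hβold hH (fun i k' hi1 hik' hk'K => ?_) hM (fun i m hi1 hiK L' hL' => ?_) (fun i m hi1 hiK L₀ hL₀ L' hL' => ?_) hHS (P := fun i => i = k₂ + 1)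
    (fun i hi1 hiK => ?_) (fun i m j hi1 hiK hP hj L' hL' => ?_) (fun i m L₀ hi1 hiK hP hL₀ L' hL' => ?_) he0 hea het hεt hεrec
  · -- (MONO) per pair (i, k'): k' = k₃ by (S-a)_{k₃}; k' = k₂ by `hpair12` (i = 1) or a silent young level; k' silent by trivial cumulative domination
    by_cases hk3 : k' = k₃
    · subst hk3; exact Or.inl fun m M' => flow_cum_dom_of_rowmass hL hh0 hanti hg hKL hrow3 m M'
    by_cases hk2' : k' = k₂
    · subst hk2'
      rcases Nat.lt_or_ge i 2 with hi | hi
      · rcases hpair12 with hrow2 | hSd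
        · exact Or.inl fun m M' => flow_cum_dom_of_rowmass hL hh0 hanti hg hKL hrow2 m M'
        · exact Or.inr (Or.inr ⟨by omega, by rw [show i = 1 by omega]; exact hSd⟩)
      · exact Or.inr (Or.inl (hsil i (by omega) (by omega) (by omega) (by omega)))
    · refine Or.inl fun m M' => ?_
      have hz := hsil k' (by omega) (by omega) hk2' hk3
      rw [sum_eq_zero fun l _ => hz _ _, sum_eq_zero fun l _ => hz _ _]
  · -- (S-b): the age 1 (one inequality), the age k₂ (`hSb2`), silent ages trivially
    by_cases hi2 : i = k₂
    · subst hi2; exact hSb2 m L' hL'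
    rcases Nat.lt_or_ge i 2 with hi | hi
    · obtain rfl : i = 1 := by omega
      obtain rfl : L' = 0 := by omega
      rw [Nat.Ico_zero_eq_range, sum_range_one, sum_range_one, Nat.add_zero]
      exact hSb1 m
    · exact silent_tail_sums hKL (hL3 i (by omega) (by omega) hi2 (by omega)) m _ _
  · by_cases hi2 : i = k₂
    · subst hi2; exact hSb2p m L₀ hL₀ L' hL'
    rcases Nat.lt_or_ge i 2 with hi | hi
    · obtain rfl : i = 1 := by omega
      obtain rfl : L₀ = 0 := by omega
      obtain rfl : L' = 0 := by omega
      rw [Ico_self, sum_empty, mul_zero]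
      exact sum_nonneg fun l _ => hKL0 1 m l
    · exact silent_tail_sums hKL (hL3 i (by omega) (by omega) hi2 (by omega)) m _ _
  · -- the levels: 1 is one-lag, k₂ is followed by the `P`-level k₂ + 1, the rest are silent
    by_cases hi2 : i = k₂
    · exact Or.inr (Or.inr (by rw [hi2]))
    rcases Nat.lt_or_ge i 2 with hi | hi
    · exact Or.inl (by omega)
    · exact Or.inr (Or.inl (hsil i (by omega) (by omega) hi2 (by omega)))
  · -- (S-c♯) above k₂: only at the `P`-level `i = k₂ + 1`
    subst hP; rw [Nat.add_sub_cancel]; exact hScTop m j hj L' hL'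
  · subst hP; rw [Nat.add_sub_cancel]; exact hScpTop m L₀ hL₀ L' hL'

end Summit.QuantumFields.BalabanUV.Beta.EriceRemainderEnclosureHistoryAutonomyComparisonAgeCompositionThreeAges

end
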